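import Summits.ResolutionOfSingularities.ResolutionOfSingularities.Theorems.EquisingularLiftEquisingularLiftNatDirLiftRingCores
import HarnessLib

/-!
# [OURS · L1 W4.5(b) · EL♮(3)] (L) C3⁺ (iii) RING CORE — comparing two lifted chart columns modulo the square of the ideal
# (res-L1-w45b-stub-4 g9's skeleton `DirLiftSkeleton-v2.lean` db5114efb4ea3c7d, brick (C3-iii) `dirLift_chartColumn_compat`, last step of the route;
# crux `EquisingularLiftNatThree` = stmt-ResolutionOfSingularities-20148, S6 (L))

res-D-pv-035 g9 (by-signature ring support, 2026-08-27T23:17:10Z). OURS; NOT a statement of any manuscript; AI-written, weaker than expert review.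
No `sorry`; standard axioms; DEF-FREE. `--supports stmt-ResolutionOfSingularities-20148 --as helper`.

WHAT (any commutative ring `R`, ideal `J`; in (C3-iii): `R = 𝒪_{X₀,p}` or `Γ(X₀, V‴)`, `J = I_p` / `I(V‴)`):
* (the unit-rescaling and unit-mod-`J` cores are res-D-pv-036's `span_singleton_sup_sq_eq_of_sub_mul_mem` / `isUnit_of_mul_sub_one_mem`,
  `…NatDirLiftRingCores` p584571 — IMPORTED, not restated);
* `sub_mul_sum_mem_sq` — the change-of-generators bookkeeping: if `x'_j = Σ_l N_jl x_l`, `t A_l − Σ_j A'_j N_jl ∈ J` and `x_l ∈ J` for all `l`,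
  then `Σ_j A'_j x'_j − t Σ_l A_l x_l ∈ J²`;
* `span_singleton_sup_sq_eq_of_changeOfGenerators` — the three combined: `(Σ A'_j x'_j) + J² = (Σ A_l x_l) + J²`.

References: folklore commutative algebra (no source needed beyond Mathlib `Ideal.mul_mem_mul`, `IsLocalRing`).
-/

set_option linter.dupNamespace false -- mandated namespace `Summit.<Summit>.<Problem>` of this single-conjunct summit

namespace Summit.ResolutionOfSingularities.ResolutionOfSingularities.Cruxes.EquisingularLiftNat.Sections

open scoped BigOperators

/-- **Change-of-generators bookkeeping modulo `J²`.** With `x'_j = Σ_l N_jl x_l`, `t A_l − Σ_j A'_j N_jl ∈ J` and `x_l ∈ J`: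
`Σ_j A'_j x'_j − t Σ_l A_l x_l ∈ J²`. [folklore] -/
theorem sub_mul_sum_mem_sq {R : Type*} [CommRing R] (J : Ideal R) {ι ι' : Type*} [Fintype ι] [Fintype ι']
    (x : ι → R) (x' : ι' → R) (A : ι → R) (A' : ι' → R) (N : ι' → ι → R) (t : R)
    (hx' : ∀ j, x' j = ∑ l, N j l * x l) (hA : ∀ l, t * A l - ∑ j, A' j * N j l ∈ J) (hx : ∀ l, x l ∈ J) :
    (∑ j, A' j * x' j) - t * ∑ l, A l * x l ∈ J ^ 2 := by
  classical
  have key : (∑ j, A' j * x' j) - t * ∑ l, A l * x l = ∑ l, (∑ j, A' j * N j l - t * A l) * x l := by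
    simp_rw [hx']
    rw [Finset.mul_sum]
    have h1 : ∑ j, A' j * ∑ l, N j l * x l = ∑ l, (∑ j, A' j * N j l) * x l := by
      simp_rw [Finset.mul_sum, Finset.sum_mul]
      rw [Finset.sum_comm]
      refine Finset.sum_congr rfl fun l _ => Finset.sum_congr rfl fun j _ => by ring
    rw [h1, ← Finset.sum_sub_distrib]
    refine Finset.sum_congr rfl fun l _ => by ring
  rw [key, pow_two]
  refine Submodule.sum_mem _ fun l _ => Ideal.mul_mem_mul ?_ (hx l)
  have : ∑ j, A' j * N j l - t * A l = -(t * A l - ∑ j, A' j * N j l) := by ring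
  rw [this]
  exact (J.neg_mem_iff).mpr (hA l)

/-- **The two lifted columns agree modulo `J²`** (the three lemmas combined): under the change-of-generators congruences and with `t` a
unit, `(Σ_j A'_j x'_j) + J² = (Σ_l A_l x_l) + J²`. [folklore] -/
theorem span_singleton_sup_sq_eq_of_changeOfGenerators {R : Type*} [CommRing R] (J : Ideal R) {ι ι' : Type*} [Fintype ι]
    [Fintype ι'] (x : ι → R) (x' : ι' → R) (A : ι → R) (A' : ι' → R) (N : ι' → ι → R) {t : R} (ht : IsUnit t)
    (hx' : ∀ j, x' j = ∑ l, N j l * x l) (hA : ∀ l, t * A l - ∑ j, A' j * N j l ∈ J) (hx : ∀ l, x l ∈ J) :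
    Ideal.span {∑ j, A' j * x' j} ⊔ J ^ 2 = Ideal.span {∑ l, A l * x l} ⊔ J ^ 2 :=
  span_singleton_sup_sq_eq_of_sub_mul_mem J ht (sub_mul_sum_mem_sq J x x' A A' N t hx' hA hx)

end Summit.ResolutionOfSingularities.ResolutionOfSingularities.Cruxes.EquisingularLiftNat.Sections
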